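import Summits.MatrixMultiplication.MatrixMultiplication.Theorems.ObstructionDescentUniversalOccurrenceTwoRectangleHookTableaux

set_option linter.dupNamespace false
set_option autoImplicit false

/-!
# Universal occurrence — two rectangles, ALL TWO-ROW TYPES, part L: the pair tableau of `(2N-2k, 2k)` (decomp-mm · lens 3 · gen 43)

Route `route-MatrixMultiplication-ObstructionDescent` (sub-problem `MatrixMultiplication`, `ω(ℂ) = 2`); SUPPORT for the crux
`NoOccurrenceObstruction` (`P_O`, item `stmt-MatrixMultiplication-29040`) through the universal-occurrence programme (NODE-g29…g43
of the decomp-mm cell, lens 3).  Nothing here proves `ω = 2` or closes an item; no `def`, no `sorry`, standard axioms.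

**Why.**  Parts H–K certified the seven types with `ν₂ ≤ 4`, `ν₃ ≤ 2`, each by a design with a FIXED number (`≤ 2`) of column
pairs.  Parts L–N treat a VARIABLE number `k` of column pairs of height `2` at once and certify every two-row type
`((2^N),(2^N),(2N-2k,2k))`, `1 ≤ k`, `2k ≤ N ≤ m` — the first family of the programme that is uniform in a shape parameter as well
as in `N` (the `k`-induction asked for in NODE-g43 §7 (α), two-row case).

**This file: the pair tableau `T` of `(2N-2k,2k)`.**  Positions `p < 4k ↦ (p mod 2, ⌊p/2⌋)` (so `4j, 4j+1` fill column `2j` and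
`4j+2, 4j+3` column `2j+1`), `p ≥ 4k ↦ (0, p-2k)` (`twoRowCell_*`).  Support (`twoRowTableau_support`): arm letters `0`, letters
`< 2`, columns injective.  Twins — `u (p+2) = u p` whenever `p < 4k`, `p mod 4 < 2` — evaluate to `1` (`twoRowTableau_twin_eq_one`:
`u = w_T ∘ ρ`, `ρ = ρ₀ · κρ₀κ` with `ρ₀` sorting the even columns and `κ` the row-wise exchange of the columns of each pair, so
`sgn ρ = sgn(ρ₀)² = 1`).

[cite: BurgisserIkenmeyer2011, §3.4 (Prop. 3.4), Thm. 4.4] [cite: BurgisserIkenmeyer2017, §5, Thm. 5.9 (proof of (2)), eq. (3.4)]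
[cite: Landsberg2017, §9.1.1]
-/

noncomputable section

open scoped BigOperators

namespace Summit.MatrixMultiplication.MatrixMultiplication.Theorems.ObstructionCalculus

open Literature.Computability.AlgebraicComplexity
open Literature.NumberTheory.DiophantineGeometry

/-! ### §1 The pair tableau of `(2N-2k, 2k)` -/

/-- Cells of the pair tableau are distinct. [folklore] -/
theorem twoRowCell_injective {k p q : ℕ}
    (hpq : (if p < 4 * k then (p % 2, p / 2) else (0, p - 2 * k) : ℕ × ℕ) =
      (if q < 4 * k then (q % 2, q / 2) else (0, q - 2 * k))) : p = q := by
  split_ifs at hpq <;> simp only [Prod.mk.injEq] at hpq <;> omega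

/-- The pair tableau is a standard filling for the position order. [folklore] -/
theorem twoRowCell_standard {k p q : ℕ} (hpq : p < q) :
    ¬ ((if q < 4 * k then (q % 2, q / 2) else (0, q - 2 * k) : ℕ × ℕ) ≤
      (if p < 4 * k then (p % 2, p / 2) else (0, p - 2 * k))) := by
  split_ifs <;> simp only [Prod.mk_le_mk] <;> omega

/-- The Young diagram of `(2N-2k,2k)` (`2k ≤ N`): its boxes. [folklore] -/
theorem mem_youngDiagram_twoRows {N k : ℕ} (ν : Nat.Partition (N * 2))
    (hν : ν.sortedParts = [2 * N - 2 * k, 2 * k]) {r c : ℕ}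
    (h : (r = 0 ∧ c < 2 * N - 2 * k) ∨ (r = 1 ∧ c < 2 * k)) :
    (r, c) ∈ ν.youngDiagram := by
  rw [Nat.Partition.mem_youngDiagram_iff, hν]
  rcases h with ⟨rfl, hc⟩ | ⟨rfl, hc⟩
  · exact ⟨by simp, by simpa using hc⟩
  · exact ⟨by simp, by simpa using hc⟩

/-- `(2N-2k,2k)` has two rows. [folklore] -/
theorem fst_lt_of_mem_youngDiagram_twoRows {N k : ℕ} (ν : Nat.Partition (N * 2))
    (hν : ν.sortedParts = [2 * N - 2 * k, 2 * k]) {x : ℕ × ℕ}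
    (hx : x ∈ ν.youngDiagram.cells) : x.1 < 2 := by
  obtain ⟨h, -⟩ := (Nat.Partition.mem_youngDiagram_iff ν x).1 ((YoungDiagram.mem_cells _).1 hx)
  rw [hν] at h
  simpa using h

/-- The cells of the pair tableau lie in `(2N-2k,2k)` (`2k ≤ N`). [folklore] -/
theorem twoRowCell_mem_twoRows {N k : ℕ} (hN : 2 * k ≤ N) (ν : Nat.Partition (N * 2))
    (hν : ν.sortedParts = [2 * N - 2 * k, 2 * k]) (p : ℕ) (hp : p < N * 2) :
    (if p < 4 * k then (p % 2, p / 2) else (0, p - 2 * k) : ℕ × ℕ) ∈ ν.youngDiagram := by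
  split_ifs with h1 <;> apply mem_youngDiagram_twoRows ν hν
  · rcases Nat.mod_two_eq_zero_or_one p with h | h
    · left; rw [h]; constructor <;> omega
    · right; rw [h]; constructor <;> omega
  · left; constructor <;> omega

/-! ### §2 Support and twins -/

/-- **Support of `e_T`.**  If `e_T(u) ≠ 0` then `u` vanishes on the arm, has letters `< 2`, and is injective on every column.
[folklore] -/
theorem twoRowTableau_support {N k : ℕ} {Y : YoungDiagram} (hN : ∀ x ∈ Y.cells, x.1 < N)
    (T : StdFilling (N * 2) Y)
    (hT : ∀ p : Fin (N * 2), T.1 p = (if (p : ℕ) < 4 * k then ((p : ℕ) % 2, (p : ℕ) / 2) else (0, (p : ℕ) - 2 * k)))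
    {u : Word N (N * 2)} (hu : T.polytabloid ℂ hN u ≠ 0) :
    (∀ p : Fin (N * 2), 4 * k ≤ (p : ℕ) → ((u p : Fin N) : ℕ) = 0) ∧
    (∀ p : Fin (N * 2), ((u p : Fin N) : ℕ) < 2) ∧
    (∀ p q : Fin (N * 2), (T.1 p).2 = (T.1 q).2 → u p = u q → p = q) := by
  classical
  obtain ⟨σ, hσ, rfl⟩ := StdFilling.exists_of_polytabloid_apply_ne_zero hN T hu
  have hcol : ∀ p, (T.1 (σ p)).2 = (T.1 p).2 := StdFilling.mem_colStab.1 hσ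
  have hval : ∀ p, ((StdFilling.rowWord hN T ∘ ⇑σ) p : ℕ) = (T.1 (σ p)).1 := fun p => rfl
  have hrow' : ∀ q : Fin (N * 2), (T.1 q).1 = if (q : ℕ) < 4 * k then (q : ℕ) % 2 else 0 := fun q => by
    rw [hT]; split_ifs <;> rfl
  have hcol' : ∀ q : Fin (N * 2), (T.1 q).2 = if (q : ℕ) < 4 * k then (q : ℕ) / 2 else (q : ℕ) - 2 * k := fun q => by
    rw [hT]; split_ifs <;> rfl
  refine ⟨fun p hp => ?_, fun p => ?_, fun p q hpq hupq => ?_⟩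
  · have hc := hcol p
    rw [hcol', hcol'] at hc
    rw [hval, hrow']
    split_ifs at hc ⊢ <;> omega
  · rw [hval, hrow']
    split_ifs <;> omega
  · have hr : (T.1 (σ p)).1 = (T.1 (σ q)).1 := by
      rw [← hval, ← hval]; exact congrArg Fin.val hupq
    have hc : (T.1 (σ p)).2 = (T.1 (σ q)).2 := by rw [hcol, hcol, hpq]
    exact σ.injective (T.injective (Prod.ext hr hc))

set_option maxHeartbeats 400000 in
/-- **Twin words evaluate to `1`.**  If `u` vanishes on the arm, has letters `< 2` and is injective on every even column, and every odd
column repeats the preceding even one (`u (p+2) = u p` for `p < 4k`, `p mod 4 < 2`), then `e_T(u) = 1`. [folklore] -/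
theorem twoRowTableau_twin_eq_one {N k : ℕ} {Y : YoungDiagram} (hN : ∀ x ∈ Y.cells, x.1 < N)
    (T : StdFilling (N * 2) Y)
    (hT : ∀ p : Fin (N * 2), T.1 p = (if (p : ℕ) < 4 * k then ((p : ℕ) % 2, (p : ℕ) / 2) else (0, (p : ℕ) - 2 * k)))
    (hk : 4 * k ≤ N * 2) {u : Word N (N * 2)}
    (harm : ∀ p : Fin (N * 2), 4 * k ≤ (p : ℕ) → ((u p : Fin N) : ℕ) = 0)
    (hlt : ∀ p : Fin (N * 2), (p : ℕ) < 4 * k → (p : ℕ) % 4 < 2 → ((u p : Fin N) : ℕ) < 2)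
    (hinj : ∀ p q : Fin (N * 2), (p : ℕ) < 4 * k → (q : ℕ) < 4 * k → (p : ℕ) % 4 < 2 → (q : ℕ) % 4 < 2 →
      (p : ℕ) / 4 = (q : ℕ) / 4 → u p = u q → p = q)
    (htwin : ∀ (p : Fin (N * 2)) (hp : (p : ℕ) < 4 * k) (hp' : (p : ℕ) % 4 < 2), u ⟨p + 2, by omega⟩ = u p) :
    T.polytabloid ℂ hN u = 1 := by
  classical
  have hrow' : ∀ q : Fin (N * 2), (T.1 q).1 = if (q : ℕ) < 4 * k then (q : ℕ) % 2 else 0 := fun q => by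
    rw [hT]; split_ifs <;> rfl
  have hcol' : ∀ q : Fin (N * 2), (T.1 q).2 = if (q : ℕ) < 4 * k then (q : ℕ) / 2 else (q : ℕ) - 2 * k := fun q => by
    rw [hT]; split_ifs <;> rfl
  -- `ρ₀`: the permutation of the even columns realising `u` there
  let S := {p : Fin (N * 2) // (p : ℕ) < 4 * k ∧ (p : ℕ) % 4 < 2}
  have hb : ∀ x : S, 4 * (((x.1 : Fin (N * 2)) : ℕ) / 4) + ((u x.1 : Fin N) : ℕ) < 4 * k := fun x => by
    have := hlt x.1 x.2.1 x.2.2; have := x.2.1; omega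
  let f₀ : S → S := fun x =>
    ⟨⟨4 * (((x.1 : Fin (N * 2)) : ℕ) / 4) + ((u x.1 : Fin N) : ℕ), by have := hb x; omega⟩,
      ⟨hb x, by have := hlt x.1 x.2.1 x.2.2; simp only; omega⟩⟩
  have hf₀v : ∀ x : S, (((f₀ x).1 : Fin (N * 2)) : ℕ) = 4 * (((x.1 : Fin (N * 2)) : ℕ) / 4) + ((u x.1 : Fin N) : ℕ) :=
    fun x => rfl
  have hf₀ : Function.Injective f₀ := by
    rintro ⟨p, hp⟩ ⟨q, hq⟩ hpq
    have h1 := congrArg (fun x : S => ((x.1 : Fin (N * 2)) : ℕ)) hpq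
    simp only [hf₀v] at h1
    apply Subtype.ext
    have hup := hlt p hp.1 hp.2
    have huq := hlt q hq.1 hq.2
    exact hinj p q hp.1 hq.1 hp.2 hq.2 (by omega) (Fin.ext (by omega))
  let F₀ : Equiv.Perm S := Equiv.ofBijective f₀ (Finite.injective_iff_bijective.1 hf₀)
  let ρ₀ : Equiv.Perm (Fin (N * 2)) := Equiv.Perm.ofSubtype F₀
  have hρ₀S : ∀ (p : Fin (N * 2)) (hp : (p : ℕ) < 4 * k ∧ (p : ℕ) % 4 < 2),
      ((ρ₀ p : Fin (N * 2)) : ℕ) = 4 * ((p : ℕ) / 4) + ((u p : Fin N) : ℕ) := by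
    intro p hp
    show ((Equiv.Perm.ofSubtype F₀ p : Fin (N * 2)) : ℕ) = _
    rw [Equiv.Perm.ofSubtype_apply_of_mem F₀ hp]
    exact hf₀v ⟨p, hp⟩
  have hρ₀_fix : ∀ p : Fin (N * 2), ¬ ((p : ℕ) < 4 * k ∧ (p : ℕ) % 4 < 2) → ρ₀ p = p := fun p hp =>
    Equiv.Perm.ofSubtype_apply_of_not_mem F₀ hp
  -- `κ`: the row-wise exchange of the two columns of each pair
  let kf : Fin (N * 2) → Fin (N * 2) := fun p =>
    if hp : (p : ℕ) < 4 * k then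
      (if hp' : (p : ℕ) % 4 < 2 then ⟨p + 2, by omega⟩ else ⟨p - 2, by omega⟩)
    else p
  have hkf : ∀ p, ((kf p : Fin (N * 2)) : ℕ) =
      if (p : ℕ) < 4 * k then (if (p : ℕ) % 4 < 2 then (p : ℕ) + 2 else (p : ℕ) - 2) else p := by
    intro p; simp only [kf]; split_ifs <;> rfl
  have hk : Function.Involutive kf := by
    intro p
    apply Fin.ext
    rw [hkf, hkf]
    split_ifs <;> omega
  let κ : Equiv.Perm (Fin (N * 2)) := Function.Involutive.toPerm kf hk
  have hκ : ∀ p, ((κ p : Fin (N * 2)) : ℕ) =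
      if (p : ℕ) < 4 * k then (if (p : ℕ) % 4 < 2 then (p : ℕ) + 2 else (p : ℕ) - 2) else p := hkf
  let ρ : Equiv.Perm (Fin (N * 2)) := ρ₀ * (κ * ρ₀ * κ)
  have hρ : ∀ p, ρ p = ρ₀ (κ (ρ₀ (κ p))) := fun p => rfl
  -- values of `ρ`
  have hρ_ev : ∀ p : Fin (N * 2), (p : ℕ) < 4 * k → (p : ℕ) % 4 < 2 →
      ((ρ p : Fin (N * 2)) : ℕ) = 4 * ((p : ℕ) / 4) + ((u p : Fin N) : ℕ) := by
    intro p hp hp'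
    have h1 : ((κ p : Fin (N * 2)) : ℕ) = p + 2 := by rw [hκ, if_pos hp, if_pos hp']
    have h2 : ρ₀ (κ p) = κ p := hρ₀_fix _ (by rw [h1]; omega)
    have h3 : κ (κ p) = p := hk p
    rw [hρ, h2, h3]
    exact hρ₀S p ⟨hp, hp'⟩
  have hρ_odd : ∀ (p : Fin (N * 2)) (hp : (p : ℕ) < 4 * k) (hp' : ¬ (p : ℕ) % 4 < 2),
      ((ρ p : Fin (N * 2)) : ℕ) = 4 * ((p : ℕ) / 4) + ((u ⟨p - 2, by omega⟩ : Fin N) : ℕ) + 2 := by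
    intro p hp hp'
    have h1 : ((κ p : Fin (N * 2)) : ℕ) = p - 2 := by rw [hκ, if_pos hp, if_neg hp']
    have h1' : κ p = ⟨p - 2, by omega⟩ := Fin.ext h1
    have h2 : ((ρ₀ (κ p) : Fin (N * 2)) : ℕ) = 4 * ((p : ℕ) / 4) + ((u ⟨p - 2, by omega⟩ : Fin N) : ℕ) := by
      rw [h1', hρ₀S _ ⟨by simp; omega, by simp; omega⟩]
      simp only
      omega
    have hu' : ((u ⟨p - 2, by omega⟩ : Fin N) : ℕ) < 2 := hlt _ (by simp; omega) (by simp; omega)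
    have h3 : ((κ (ρ₀ (κ p)) : Fin (N * 2)) : ℕ) = 4 * ((p : ℕ) / 4) + ((u ⟨p - 2, by omega⟩ : Fin N) : ℕ) + 2 := by
      rw [hκ, h2, if_pos (by omega), if_pos (by omega)]
    have h4 : ρ₀ (κ (ρ₀ (κ p))) = κ (ρ₀ (κ p)) := hρ₀_fix _ (by rw [h3]; omega)
    rw [hρ, h4, h3]
  have hρ_ge : ∀ p : Fin (N * 2), 4 * k ≤ (p : ℕ) → ρ p = p := by
    intro p hp
    have h1 : κ p = p := Fin.ext (by rw [hκ]; split_ifs <;> omega)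
    have h2 : ρ₀ p = p := hρ₀_fix _ (by omega)
    rw [hρ, h1, h2, h1, h2]
  -- `ρ` is a column permutation and `u = w_T ∘ ρ`
  have hρC : ρ ∈ T.colStab := by
    rw [StdFilling.mem_colStab]
    intro p
    rw [hcol', hcol']
    by_cases h0 : (p : ℕ) < 4 * k
    · by_cases h1 : (p : ℕ) % 4 < 2
      · have e1 := hρ_ev p h0 h1
        have := hlt p h0 h1
        rw [if_pos (by omega), if_pos h0, e1]
        omega
      · have e1 := hρ_odd p h0 h1
        have := hlt ⟨p - 2, by omega⟩ (by simp; omega) (by simp; omega)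
        rw [if_pos (by omega), if_pos h0, e1]
        omega
    · rw [hρ_ge p (by omega)]
  have hw : u = StdFilling.rowWord hN T ∘ ⇑ρ := by
    funext p
    apply Fin.ext
    show ((u p : Fin N) : ℕ) = (T.1 (ρ p)).1
    rw [hrow']
    by_cases h0 : (p : ℕ) < 4 * k
    · by_cases h1 : (p : ℕ) % 4 < 2
      · have e1 := hρ_ev p h0 h1
        have := hlt p h0 h1
        rw [if_pos (by omega), e1]
        omega
      · have e1 := hρ_odd p h0 h1
        have hu' := hlt ⟨p - 2, by omega⟩ (by simp; omega) (by simp; omega)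
        rw [if_pos (by omega), e1]
        have e2 := htwin ⟨p - 2, by omega⟩ (by simp; omega) (by simp; omega)
        have e3 : (⟨((⟨(p : ℕ) - 2, by omega⟩ : Fin (N * 2)) : ℕ) + 2, by simp; omega⟩ : Fin (N * 2)) = p :=
          Fin.ext (by simp; omega)
        rw [e3] at e2
        rw [e2]
        omega
    · rw [hρ_ge p (by omega), if_neg h0]
      exact harm p (by omega)
  have key := congrFun (StdFilling.wordPerm_polytabloid_of_mem_colStab (k := ℂ) hN T hρC)
    (StdFilling.rowWord hN T)
  rw [wordPerm_apply, ← hw, Pi.smul_apply, StdFilling.polytabloid_apply_rowWord, smul_eq_mul,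
    mul_one] at key
  rw [key]
  have hs : Equiv.Perm.sign ρ = 1 := by
    show Equiv.Perm.sign (ρ₀ * (κ * ρ₀ * κ)) = 1
    simp only [Equiv.Perm.sign_mul]
    rcases Int.units_eq_one_or (Equiv.Perm.sign ρ₀) with h1 | h1 <;>
    rcases Int.units_eq_one_or (Equiv.Perm.sign κ) with h2 | h2 <;> simp [h1, h2]
  rw [hs]
  simp

end Summit.MatrixMultiplication.MatrixMultiplication.Theorems.ObstructionCalculus
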